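import Summits.ValiantsHypothesis.ValiantsHypothesis.Theorems.MonotoneRestorationOrbitRestorationQPValueSymSupport
import Summits.ValiantsHypothesis.ValiantsHypothesis.Theorems.MonotoneRestorationOrbitRestorationQPValueOrbitIff
import HarnessLib

/-!
# The crux in SUPPORT currency: `OrbitRestorationQP` ⟺ polylog rigid supports for all intermediate values (ORBIT currency, XXI)

Route MonotoneRestoration, crux `OrbitRestorationQP` (stmt-ValiantsHypothesis-18293), namespace
`Summit.ValiantsHypothesis.ValiantsHypothesis.Theorems.ValueSymSupport` (continued).

The support theorem for values (`ValueSymSupport.exists_symSupport`, hypotheses `n > 8`, `3 ≤ k ≤ n/4`, orbits `< C(n,k)`) is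
repackaged in the crux's own quasi-polynomial scale, with no side conditions: if every value of a value derivation on the
`n × n` matrix has at most `2^((log₂ n + c)^c)` diagonal translates, then every value is fixed by the pointwise stabiliser of at
most `(log₂ n + c + 4)^(c+4)` indices (`exists_support_le_polylog`; small `n` are absorbed by the trivial support `univ`).  With
the landed converse `ValueOrbit.orbit_bounded_of_supported` (support `k` ⇒ orbit `≤ (n+1)^k`) and the value form of the crux
(`ValueOrbit.orbitRestorationQP_iff_valueOrbitQP`) this gives the crux in the currency of Dawar–Wilsenach's support theorem:

  `OrbitRestorationQP ⟺` every matrix-symmetric `VP` family has, for one `c` and all `n`, SOME ordinary computation of `f n`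
  every intermediate value of which is fixed by the pointwise stabiliser of `≤ (log₂ n + c)^c` indices
  (`orbitRestorationQP_iff_supportQP`).

Orbit width and rigid supports are the same currency for the crux; neither side is claimed.  Arithmetic: `2^k ≤ C(n,k)` for
`4k ≤ n` (`two_pow_le_choose`), `(n+1)^((L+c)^c) ≤ 2^((L+c+1)^(c+1))` (`succ_pow_polylog_le`).  Everything is proved. [folklore]

## References
* A. Dawar, G. Wilsenach, *Symmetric arithmetic circuits*, ToC 21 (2025), Def. 6.1, Thms 6.3, 7.1. [DawarWilsenach2025]
-/

noncomputable section

open scoped Classical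

-- `Summit.ValiantsHypothesis.ValiantsHypothesis.…` is the tree's single-conjunct layout (Sub = Summit).
set_option linter.dupNamespace false

namespace Summit.ValiantsHypothesis.ValiantsHypothesis.Theorems

namespace ValueSymSupport

open Equiv Literature.Computability.AlgebraicComplexity

variable {n : ℕ}

/-! ### Arithmetic -/

/-- `2^k ≤ C(n,k)` when `4k ≤ n`. [folklore] -/
theorem two_pow_le_choose : ∀ (n k : ℕ), 4 * k ≤ n → 2 ^ k ≤ n.choose k := by
  intro n k
  induction k with
  | zero => intro _; simp
  | succ k ih =>
    intro hk
    have h1 : 2 ^ k ≤ n.choose k := ih (by omega)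
    have h2 : n.choose (k + 1) * (k + 1) = n.choose k * (n - k) := Nat.choose_succ_right_eq n k
    have h3 : 2 ^ (k + 1) * (k + 1) ≤ n.choose (k + 1) * (k + 1) := by
      rw [h2, pow_succ]
      calc 2 ^ k * 2 * (k + 1) = 2 ^ k * (2 * (k + 1)) := by ring
        _ ≤ n.choose k * (n - k) := Nat.mul_le_mul h1 (by omega)
    exact Nat.le_of_mul_le_mul_right h3 (Nat.succ_pos k)

/-- `(L+1)·(L+c)^c ≤ (L+c+1)^(c+1)`. [folklore] -/
theorem succ_mul_pow_le (L c : ℕ) : (L + 1) * (L + c) ^ c ≤ (L + c + 1) ^ (c + 1) := by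
  rw [pow_succ, mul_comm]
  exact Nat.mul_le_mul (Nat.pow_le_pow_left (Nat.le_succ _) c) (by omega)

/-- `(n+1)^((log₂ n + c)^c) ≤ 2^((log₂ n + c + 1)^(c+1))`. [folklore] -/
theorem succ_pow_polylog_le (n c : ℕ) :
    (n + 1) ^ ((Nat.log 2 n + c) ^ c) ≤ 2 ^ ((Nat.log 2 n + (c + 1)) ^ (c + 1)) := by
  have hL : n + 1 ≤ 2 ^ (Nat.log 2 n + 1) := Nat.lt_pow_succ_log_self Nat.one_lt_two n
  calc (n + 1) ^ ((Nat.log 2 n + c) ^ c) ≤ (2 ^ (Nat.log 2 n + 1)) ^ ((Nat.log 2 n + c) ^ c) :=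
        Nat.pow_le_pow_left hL _
    _ = 2 ^ ((Nat.log 2 n + 1) * (Nat.log 2 n + c) ^ c) := by rw [← pow_mul]
    _ ≤ 2 ^ ((Nat.log 2 n + (c + 1)) ^ (c + 1)) :=
        Nat.pow_le_pow_right (by norm_num) (by rw [← add_assoc]; exact succ_mul_pow_le _ _)

/-- `256·(L+c)^c ≤ (L+c+4)^(c+4)`. [folklore] -/
theorem pow_polylog_absorb (L c : ℕ) : 256 * (L + c) ^ c ≤ (L + (c + 4)) ^ (c + 4) := by
  rw [pow_add, mul_comm]
  refine Nat.mul_le_mul (Nat.pow_le_pow_left (by omega) c) ?_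
  calc 256 = 4 ^ 4 := by norm_num
    _ ≤ (L + (c + 4)) ^ 4 := Nat.pow_le_pow_left (by omega) 4

/-! ### The support theorem at quasi-polynomial scale -/

/-- **Quasi-polynomial orbits ⇒ polylogarithmic supports, for all `n`.**  If every value of a value derivation on the
`n × n` matrix has at most `2^((log₂ n + c)^c)` diagonal translates, then every value is fixed by every permutation fixing
pointwise some set of at most `(log₂ n + c + 4)^(c+4)` indices. [folklore; cite: DawarWilsenach2025, Def. 6.1] -/
theorem exists_support_le_polylog (c : ℕ) (𝒟 : ValueDerivation ℂ (Fin n × Fin n))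
    (hS : ∀ q ∈ 𝒟.S, (Set.range fun σ : Perm (Fin n) => ren σ q).ncard ≤ 2 ^ ((Nat.log 2 n + c) ^ c)) :
    ∀ q ∈ 𝒟.S, ∃ X : Finset (Fin n), X.card ≤ (Nat.log 2 n + (c + 4)) ^ (c + 4) ∧
      ∀ ρ : Perm (Fin n), (∀ x ∈ X, ρ x = x) → ren ρ q = q := by
  set K := (Nat.log 2 n + c) ^ c with hK
  have hK1 : 1 ≤ K := by
    rcases Nat.eq_zero_or_pos c with rfl | hc
    · simp [hK]
    · exact Nat.one_le_pow _ _ (by omega)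
  have habs := pow_polylog_absorb (Nat.log 2 n) c
  intro q hq
  by_cases h : 8 < n ∧ 4 * (K + 3) ≤ n
  · -- large `n`: the support theorem with `k = K + 3`
    have hlt : ∀ q ∈ 𝒟.S, (Set.range fun σ : Perm (Fin n) => ren σ q).ncard < n.choose (K + 3) := by
      intro q hq
      refine (hS q hq).trans_lt ?_
      calc 2 ^ K < 2 ^ (K + 3) := Nat.pow_lt_pow_right (by norm_num) (by omega)
        _ ≤ n.choose (K + 3) := two_pow_le_choose n (K + 3) h.2
    obtain ⟨X, hXk, hX⟩ := exists_symSupport h.1 (by omega) h.2 𝒟 hlt q hq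
    exact ⟨X, by omega, hX⟩
  · -- small `n`: the trivial support
    refine ⟨Finset.univ, ?_, fun ρ hρ => ?_⟩
    · rw [Finset.card_univ, Fintype.card_fin]
      omega
    · have : ρ = 1 := Equiv.ext fun x => hρ x (Finset.mem_univ x)
      rw [this, ren_one]

/-! ### The crux in support currency -/

/-- **`OrbitRestorationQP` ⟺ POLYLOG RIGID SUPPORTS.**  The crux holds iff every matrix-symmetric `VP` family has, for one
constant `c` and every `n`, SOME value derivation of `f n` (an ordinary computation of any length) every value of which is
fixed by the pointwise stabiliser of at most `(log₂ n + c)^c` indices.  (`⇒`: value form of the crux and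
`exists_support_le_polylog`; `⇐`: `ValueOrbit.orbit_bounded_of_supported` and `succ_pow_polylog_le`.)  Neither side is claimed.
[folklore; cite: DawarWilsenach2025, Thm 6.3] -/
theorem orbitRestorationQP_iff_supportQP :
    Theses.MonotoneRestoration.OrbitRestorationQP ↔
    ∀ f : (n : ℕ) → MvPolynomial (Fin n × Fin n) ℂ,
      (∀ (n : ℕ) (σ τ : Equiv.Perm (Fin n)),
        MvPolynomial.rename (fun p : Fin n × Fin n => (σ p.1, τ p.2)) (f n) = f n) →
      IsVPFamily f →
      ∃ c : ℕ, ∀ n : ℕ, ∃ 𝒟 : ValueDerivation ℂ (Fin n × Fin n), f n ∈ 𝒟.S ∧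
        ∀ q ∈ 𝒟.S, ∃ X : Finset (Fin n), X.card ≤ (Nat.log 2 n + c) ^ c ∧
          ∀ ρ : Equiv.Perm (Fin n), (∀ x ∈ X, ρ x = x) → ren ρ q = q := by
  rw [ValueOrbit.orbitRestorationQP_iff_valueOrbitQP]
  constructor
  · intro h f hsymm hVP
    obtain ⟨c, hc⟩ := h f hsymm hVP
    refine ⟨c + 4, fun n => ?_⟩
    obtain ⟨𝒟, hf, hS⟩ := hc n
    exact ⟨𝒟, hf, exists_support_le_polylog c 𝒟 hS⟩
  · intro h f hsymm hVP
    obtain ⟨c, hc⟩ := h f hsymm hVP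
    refine ⟨c + 1, fun n => ?_⟩
    obtain ⟨𝒟, hf, hS⟩ := hc n
    refine ⟨𝒟, hf, fun q hq => ?_⟩
    obtain ⟨X, hXk, hX⟩ := hS q hq
    calc (Set.range fun σ : Perm (Fin n) => ren σ q).ncard ≤ (n + 1) ^ X.card :=
          ValueOrbit.orbit_bounded_of_supported hX
      _ ≤ (n + 1) ^ ((Nat.log 2 n + c) ^ c) := Nat.pow_le_pow_right (Nat.succ_pos n) hXk
      _ ≤ 2 ^ ((Nat.log 2 n + (c + 1)) ^ (c + 1)) := succ_pow_polylog_le n c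

end ValueSymSupport

end Summit.ValiantsHypothesis.ValiantsHypothesis.Theorems

end
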